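import Summits.ResolutionOfSingularities.ResolutionOfSingularities.Theorems.EquisingularLiftEquisingularLiftNatNDFrameChartFlat
import Summits.ResolutionOfSingularities.ResolutionOfSingularities.Theorems.EquisingularLiftEquisingularLiftNatNDRoundModel
import Summits.ResolutionOfSingularities.ResolutionOfSingularities.Theorems.EquisingularLiftEquisingularLiftNatNDFibreRegular
import Literature.AlgebraicGeometry.Resolution.BlowupsFlatBaseChange
import Literature.AlgebraicGeometry.Resolution.RegularLocusPerfectFibre
import Mathlib.AlgebraicGeometry.Morphisms.Flat
import Mathlib.AlgebraicGeometry.Noetherian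
import HarnessLib

/-!
# [OURS · L1 W4.5(b) · EL♮(3)] ND-K5 (B4β2) SCHEME GLUE — local rings of the LINKED F-stage over `x` are regular

OURS · L1 W4.5(b) · EL♮(3) stmt-ResolutionOfSingularities-20148 (parent EL♮ stmt-…-20038) · counted 0 · AI-written (res-L1-w45b-iso-w2 g0, WIDTH seat on
D-0157 DOOR 1, desk WIDTH TABLE D1′ row iso-w2 = (B4β2) `transportEnd`), weaker than expert review; nothing of [Hironaka2017] asserted; no statement of the
manuscript; resolution of singularities in positive characteristic is NOT proved here or by this.  Def-free, sorry-free, standard axioms.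
`--supports stmt-ResolutionOfSingularities-20148 --as helper`.

WHAT.  The REGULARITY half of (B4β2) `ND.transportEnd` (SPEC v11 §13.15) in raw form (no `FStage`/`Linked`/`ToricStage` wrappers, so that it elaborates
before the port `…NatNDRoundModelSplit` lands): in the two pullback squares of `Linked` —

  `a : L ⟶ F`, `c : L ⟶ Spec 𝒪_{F₁,x}` cartesian over `φF : F ⟶ F₁`, `F₁.fromSpecStalk x`;  `b : L ⟶ A`, `c` cartesian over `φA : A ⟶ 𝔸ⁿ_k` and the
  frame base map `Spec 𝒪_{F₁,x} ⟶ 𝔸ⁿ_k`, `Xᵢ ↦ wᵢ` —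

every local ring `𝒪_{F,y}` at a point `y` over `x` is REGULAR, provided: `k` algebraically closed, `𝒪_{F₁,x}` Noetherian of dimension `n` with maximal ideal
`(w₁, …, wₙ)`, and the image `z ∈ A` of a point of `L` over `y` has an AFFINE open neighbourhood `U` whose coordinate ring `Γ(A, U)` is a REGULAR ring of FINITE
TYPE over `k[X₁, …, Xₙ]` (through `φA`) — which is what a toric chart `𝔸ⁿ_k ≅ U` of a `ToricStage` supplies (`isRegularRing_and_finiteType_of_chart`).

PROOF.  `y = a ℓ` with `c ℓ` the closed point (pullback of `fromSpecStalk`); `𝒪_{F,y} ≅ 𝒪_{L,ℓ}` (`a` is a flat preimmersion as a base change of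
`fromSpecStalk x`: tree `isIso_stalkMap_of_flat_of_isPreimmersion`); `V = b⁻¹U` is affine with `Γ(L,V) ≅ Γ(A,U) ⊗_{k[X]} 𝒪_{F₁,x}` (Mathlib
`isIso_pushoutSection_of_isAffineOpen` on the second square, rebased along `ΓSpecIso`); `𝒪_{L,ℓ} = Γ(L,V)_𝔔` with `𝔔` over the ORIGIN of `k[X]` (because
`c ℓ` is the closed point and `(X)·𝒪_{F₁,x} = 𝔪ₓ`, `ND.map_originIdeal_frameChart`); then the ring-level core
`ND.isRegularLocalRing_localization_tensor_iff_of_under_eq_originIdeal` (✓ `…NatNDFibreRegular`: flatness `ND.flat_frameChart` p642337 + Stacks 0381 over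
the algebraically closed `k` — `κ(x)` arbitrary) reduces regularity of `Γ(L,V)_𝔔` to that of a localization of the regular ring `Γ(A,U)`.

FEEDS.  (B4β2) `ND.transportEnd` = this + the off-`x` case (`FStage`'s iso) + the END half (same glue on `Γ(A,U)/J`).
-/

set_option linter.dupNamespace false

open CategoryTheory CategoryTheory.Limits AlgebraicGeometry TopologicalSpace Topology
open MvPolynomial TensorProduct
open Literature.AlgebraicGeometry.Resolution
open AlgebraicGeometry.Scheme.IdealSheafData

namespace Summit.ResolutionOfSingularities.ResolutionOfSingularities.Cruxes.EquisingularLiftNat.Sections.ND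

/-- In a cartesian square over `F₁.fromSpecStalk x`, every point of `F` over `x` lifts to a point of `L` over the CLOSED point of `Spec 𝒪_{F₁,x}`.
[OURS · plumbing] -/
theorem exists_preimage_of_isPullback_fromSpecStalk {F₁ F L : Scheme.{0}} (x : F₁) {a : L ⟶ F}
    {c : L ⟶ Spec (F₁.presheaf.stalk x)} {φF : F ⟶ F₁} (sq : IsPullback a c φF (F₁.fromSpecStalk x)) (y : F) (hy : φF y = x) :
    ∃ ℓ : L, a ℓ = y ∧ c ℓ = IsLocalRing.closedPoint (F₁.presheaf.stalk x) := by
  obtain ⟨z, hz1, hz2⟩ := Scheme.Pullback.exists_preimage_pullback (f := φF) (g := F₁.fromSpecStalk x) y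
    (IsLocalRing.closedPoint (F₁.presheaf.stalk x)) (by rw [hy, Scheme.fromSpecStalk_closedPoint])
  refine ⟨sq.isoPullback.inv z, ?_, ?_⟩
  · rw [← Scheme.Hom.comp_apply, sq.isoPullback_inv_fst, hz1]
  · rw [← Scheme.Hom.comp_apply, sq.isoPullback_inv_snd, hz2]

/-- In a cartesian square over `F₁.fromSpecStalk x`, `a : L ⟶ F` induces isomorphisms of local rings (a flat preimmersion). [OURS · plumbing] -/
theorem isIso_stalkMap_of_isPullback_fromSpecStalk {F₁ F L : Scheme.{0}} (x : F₁) {a : L ⟶ F}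
    {c : L ⟶ Spec (F₁.presheaf.stalk x)} {φF : F ⟶ F₁} (sq : IsPullback a c φF (F₁.fromSpecStalk x)) (ℓ : L) :
    IsIso (a.stalkMap ℓ) := by
  haveI := flat_fromSpecStalk F₁ x
  haveI : Flat a := MorphismProperty.IsStableUnderBaseChange.of_isPullback sq.flip inferInstance
  haveI : IsPreimmersion a := MorphismProperty.IsStableUnderBaseChange.of_isPullback sq.flip inferInstance
  exact isIso_stalkMap_of_flat_of_isPreimmersion a ℓ

/-- **(B4β2) SCHEME GLUE, REGULARITY HALF.**  See the module docstring.  [OURS · L1 W4.5b · ND-K5 (B4β2)] -/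
theorem isRegularLocalRing_stalk_of_linked (n : ℕ) (k : Type) [Field k] [IsAlgClosed k]
    {F₁ : Scheme.{0}} (ρ : F₁ ⟶ (Literature.AlgebraicGeometry.Motives.projectiveSpace n k).left) (x : F₁)
    [IsNoetherianRing (F₁.presheaf.stalk x)] (w : Fin n → F₁.presheaf.stalk x)
    (hw : Ideal.span (Set.range w) = IsLocalRing.maximalIdeal (F₁.presheaf.stalk x))
    (hdim : ringKrullDim (F₁.presheaf.stalk x) = n)
    {L F A : Scheme.{0}} (a : L ⟶ F) (b : L ⟶ A) (c : L ⟶ Spec (F₁.presheaf.stalk x)) (φF : F ⟶ F₁) (φA : A ⟶ Aff n k)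
    (sqF : IsPullback a c φF (F₁.fromSpecStalk x))
    (sqA : IsPullback b c φA (Spec.map (CommRingCat.ofHom (MvPolynomial.eval₂Hom (baseToStalk n k ρ x) w))))
    (hchart : ∀ z : A, φA z = affOrigin n k → ∃ U : A.Opens, z ∈ U ∧ IsAffineOpen U ∧ IsRegularRing Γ(A, U) ∧
      ((φA.appLE ⊤ U le_top).hom.comp (Scheme.ΓSpecIso (.of (MvPolynomial (Fin n) k))).inv.hom).FiniteType)
    (y : F) (hy : φF y = x) : IsRegularLocalRing (F.presheaf.stalk y) := by
  classical
  -- (1) lift `y` to `ℓ ∈ L` over the closed point, and pass to `𝒪_{L,ℓ}`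
  obtain ⟨ℓ, rfl, hℓ⟩ := exists_preimage_of_isPullback_fromSpecStalk x sqF y hy
  haveI := isIso_stalkMap_of_isPullback_fromSpecStalk x sqF ℓ
  suffices hL : IsRegularLocalRing (L.presheaf.stalk ℓ) from
    IsRegularLocalRing.of_ringEquiv (asIso (a.stalkMap ℓ)).commRingCatIsoToRingEquiv.symm
  -- (2) the image `z = b ℓ` lies over the origin (`c ℓ` is the closed point and `(X)·𝒪ₓ` pulls back to the origin ideal)
  have hz0 : φA (b ℓ) = affOrigin n k := by
    rw [← Scheme.Hom.comp_apply, sqA.w, Scheme.Hom.comp_apply, hℓ, Spec.map_apply]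
    apply PrimeSpectrum.ext
    exact (map_originIdeal_frameChart n k F₁ ρ x w hw).2
  obtain ⟨U, hzU, hU, hUreg, hUft⟩ := hchart (b ℓ) hz0
  -- (3) the affine open `V = b⁻¹ U` of `L` and its coordinate ring as a pushout
  have hUST : (⊤ : (Spec (F₁.presheaf.stalk x)).Opens) ≤
      (Spec.map (CommRingCat.ofHom (MvPolynomial.eval₂Hom (baseToStalk n k ρ x) w))) ⁻¹ᵁ ⊤ := le_top
  have hUSX : U ≤ φA ⁻¹ᵁ ⊤ := le_top
  have hVdef : b ⁻¹ᵁ U ⊓ c ⁻¹ᵁ ⊤ = b ⁻¹ᵁ U ⊓ c ⁻¹ᵁ ⊤ := rfl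
  have hℓV : ℓ ∈ b ⁻¹ᵁ U ⊓ c ⁻¹ᵁ ⊤ := ⟨hzU, trivial⟩
  haveI : IsAffine (⊤ : (Aff n k).Opens) := isAffineOpen_top (Aff n k)
  haveI : IsAffine (⊤ : (Spec (F₁.presheaf.stalk x)).Opens) := isAffineOpen_top _
  haveI : IsAffine U := hU
  have hV : IsAffineOpen (b ⁻¹ᵁ U ⊓ c ⁻¹ᵁ ⊤) :=
    IsAffine.of_isIso (Scheme.Hom.isPullback_resLE sqA hUST hUSX hVdef).isoPullback.hom
  have hpo := (isIso_pushoutSection_iff sqA hUST hUSX hVdef).mp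
      (isIso_pushoutSection_of_isAffineOpen sqA hUST hUSX hVdef (isAffineOpen_top _) (isAffineOpen_top _) hU)
  -- rebase the span on `R = k[X]` and `Λ = 𝒪_{F₁,x}` through `ΓSpecIso`
  have hh_app : (Spec.map (CommRingCat.ofHom (MvPolynomial.eval₂Hom (baseToStalk n k ρ x) w))).appLE ⊤ ⊤ hUST ≫
      (Scheme.ΓSpecIso (F₁.presheaf.stalk x)).hom =
      (Scheme.ΓSpecIso (.of (MvPolynomial (Fin n) k))).hom ≫ CommRingCat.ofHom (MvPolynomial.eval₂Hom (baseToStalk n k ρ x) w) := by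
    rw [Scheme.Hom.appLE]
    simp only [Opens.map_top, homOfLE_refl, op_id, CategoryTheory.Functor.map_id, Category.comp_id]
    exact Scheme.ΓSpecIso_naturality (CommRingCat.ofHom (MvPolynomial.eval₂Hom (baseToStalk n k ρ x) w))
  have hpo' : IsPushout
      (CommRingCat.ofHom ((φA.appLE ⊤ U hUSX).hom.comp (Scheme.ΓSpecIso (.of (MvPolynomial (Fin n) k))).inv.hom))
      (CommRingCat.ofHom (MvPolynomial.eval₂Hom (baseToStalk n k ρ x) w))
      (b.appLE U (b ⁻¹ᵁ U ⊓ c ⁻¹ᵁ ⊤) (by simp))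
      ((Scheme.ΓSpecIso (F₁.presheaf.stalk x)).inv ≫ c.appLE ⊤ (b ⁻¹ᵁ U ⊓ c ⁻¹ᵁ ⊤) (by simp)) := by
    refine hpo.of_iso (Scheme.ΓSpecIso (.of (MvPolynomial (Fin n) k))) (Iso.refl _) (Scheme.ΓSpecIso (F₁.presheaf.stalk x)) (Iso.refl _)
      ?_ ?_ ?_ ?_
    · rw [Iso.refl_hom, Category.comp_id, CommRingCat.ofHom_comp, CommRingCat.ofHom_hom, CommRingCat.ofHom_hom,
        ← Category.assoc, Iso.hom_inv_id, Category.id_comp]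
    · exact hh_app
    · rw [Iso.refl_hom, Iso.refl_hom, Category.comp_id, Category.id_comp]
    · rw [Iso.refl_hom, Category.comp_id, Iso.hom_inv_id_assoc]
  letI algA : Algebra (MvPolynomial (Fin n) k) Γ(A, U) :=
    ((φA.appLE ⊤ U hUSX).hom.comp (Scheme.ΓSpecIso (.of (MvPolynomial (Fin n) k))).inv.hom).toAlgebra
  letI algΛ : Algebra (MvPolynomial (Fin n) k) (F₁.presheaf.stalk x) := (MvPolynomial.eval₂Hom (baseToStalk n k ρ x) w).toAlgebra
  have hpoT := CommRingCat.isPushout_tensorProduct (MvPolynomial (Fin n) k) Γ(A, U) (F₁.presheaf.stalk x)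
  rw [show CommRingCat.ofHom (algebraMap (MvPolynomial (Fin n) k) Γ(A, U)) =
      CommRingCat.ofHom ((φA.appLE ⊤ U hUSX).hom.comp (Scheme.ΓSpecIso (.of (MvPolynomial (Fin n) k))).inv.hom) from rfl,
    show CommRingCat.ofHom (algebraMap (MvPolynomial (Fin n) k) (F₁.presheaf.stalk x)) =
      CommRingCat.ofHom (MvPolynomial.eval₂Hom (baseToStalk n k ρ x) w) from rfl] at hpoT
  let eP : CommRingCat.of (Γ(A, U) ⊗[MvPolynomial (Fin n) k] (F₁.presheaf.stalk x)) ≅ Γ(L, b ⁻¹ᵁ U ⊓ c ⁻¹ᵁ ⊤) :=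
    hpoT.isoIsPushout _ _ hpo'
  have heP_inl : CommRingCat.ofHom (Algebra.TensorProduct.includeLeftRingHom :
      Γ(A, U) →+* Γ(A, U) ⊗[MvPolynomial (Fin n) k] (F₁.presheaf.stalk x)) ≫ eP.hom = b.appLE U (b ⁻¹ᵁ U ⊓ c ⁻¹ᵁ ⊤) (by simp) :=
    hpoT.inl_isoIsPushout_hom _ _ hpo'
  let e : Γ(A, U) ⊗[MvPolynomial (Fin n) k] (F₁.presheaf.stalk x) ≃+* (Γ(L, b ⁻¹ᵁ U ⊓ c ⁻¹ᵁ ⊤) : Type) :=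
    eP.commRingCatIsoToRingEquiv
  have he : (e : Γ(A, U) ⊗[MvPolynomial (Fin n) k] (F₁.presheaf.stalk x) →+* (Γ(L, b ⁻¹ᵁ U ⊓ c ⁻¹ᵁ ⊤) : Type)) = eP.hom.hom := rfl
  -- (4) the prime `𝔔` of `Γ(L, V)` at `ℓ`, and its transport `𝔔'` to `Γ(A,U) ⊗ 𝒪ₓ`
  haveI hQp : (hV.primeIdealOf ⟨ℓ, hℓV⟩).asIdeal.IsPrime := (hV.primeIdealOf ⟨ℓ, hℓV⟩).isPrime
  haveI hQ'p : ((hV.primeIdealOf ⟨ℓ, hℓV⟩).asIdeal.comap e).IsPrime := Ideal.IsPrime.comap _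
  -- `𝔔'` lies over the origin
  have hcompR : (e : Γ(A, U) ⊗[MvPolynomial (Fin n) k] (F₁.presheaf.stalk x) →+* (Γ(L, b ⁻¹ᵁ U ⊓ c ⁻¹ᵁ ⊤) : Type)).comp
      (algebraMap (MvPolynomial (Fin n) k) (Γ(A, U) ⊗[MvPolynomial (Fin n) k] (F₁.presheaf.stalk x))) =
      ((b ≫ φA).appLE ⊤ (b ⁻¹ᵁ U ⊓ c ⁻¹ᵁ ⊤) le_top).hom.comp (Scheme.ΓSpecIso (.of (MvPolynomial (Fin n) k))).inv.hom := by
    have h1 : algebraMap (MvPolynomial (Fin n) k) (Γ(A, U) ⊗[MvPolynomial (Fin n) k] (F₁.presheaf.stalk x)) =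
        (Algebra.TensorProduct.includeLeftRingHom : Γ(A, U) →+* Γ(A, U) ⊗[MvPolynomial (Fin n) k] (F₁.presheaf.stalk x)).comp
          ((φA.appLE ⊤ U hUSX).hom.comp (Scheme.ΓSpecIso (.of (MvPolynomial (Fin n) k))).inv.hom) := by
      ext r <;> simp [Algebra.TensorProduct.algebraMap_apply, RingHom.algebraMap_toAlgebra]
    have h2 : eP.hom.hom.comp (Algebra.TensorProduct.includeLeftRingHom :
        Γ(A, U) →+* Γ(A, U) ⊗[MvPolynomial (Fin n) k] (F₁.presheaf.stalk x)) = (b.appLE U (b ⁻¹ᵁ U ⊓ c ⁻¹ᵁ ⊤) (by simp)).hom := by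
      rw [← heP_inl]
      rfl
    rw [h1, ← RingHom.comp_assoc, he, h2, ← RingHom.comp_assoc]
    congr 1
    rw [← CommRingCat.hom_comp, Scheme.Hom.appLE_comp_appLE]
  have hQ' : ((hV.primeIdealOf ⟨ℓ, hℓV⟩).asIdeal.comap e).under (MvPolynomial (Fin n) k) =
      Literature.AlgebraicGeometry.Resolution.originIdeal k n := by
    rw [Ideal.under_def, show Ideal.comap e (hV.primeIdealOf ⟨ℓ, hℓV⟩).asIdeal =
        Ideal.comap (e : Γ(A, U) ⊗[MvPolynomial (Fin n) k] (F₁.presheaf.stalk x) →+* (Γ(L, b ⁻¹ᵁ U ⊓ c ⁻¹ᵁ ⊤) : Type))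
          (hV.primeIdealOf ⟨ℓ, hℓV⟩).asIdeal from rfl,
      Ideal.comap_comap, hcompR, ← Ideal.comap_comap]
    have h1 : (hV.primeIdealOf ⟨ℓ, hℓV⟩).asIdeal.comap ((b ≫ φA).appLE ⊤ (b ⁻¹ᵁ U ⊓ c ⁻¹ᵁ ⊤) le_top).hom =
        ((isAffineOpen_top (Aff n k)).primeIdealOf ⟨(b ≫ φA) ℓ, trivial⟩).asIdeal :=
      congrArg PrimeSpectrum.asIdeal (IsAffineOpen.comap_primeIdealOf_appLE ⊤ (isAffineOpen_top _) _ hV le_top hℓV)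
    rw [h1]
    -- the prime of `Γ(𝔸ⁿ, ⊤)` at a point `p`, pulled back along `ΓSpecIso⁻¹`, is `p`
    have h2 : ∀ p : Aff n k, (((isAffineOpen_top (Aff n k)).primeIdealOf ⟨p, trivial⟩).asIdeal).comap
        (Scheme.ΓSpecIso (.of (MvPolynomial (Fin n) k))).inv.hom = p.asIdeal := by
      intro p
      rw [IsAffineOpen.primeIdealOf_eq_map_closedPoint, Spec.map_apply, PrimeSpectrum.comap_asIdeal, Ideal.comap_comap,
        ← CommRingCat.hom_comp]
      have h3 : (Scheme.ΓSpecIso (.of (MvPolynomial (Fin n) k))).inv ≫ (Aff n k).presheaf.germ ⊤ p trivial =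
          StructureSheaf.toStalk (MvPolynomial (Fin n) k) p := by
        rw [Scheme.ΓSpecIso_inv]; rfl
      rw [h3]
      letI := StructureSheaf.stalkAlgebra (MvPolynomial (Fin n) k) p
      haveI : IsLocalization.AtPrime ((Spec.structureSheaf (MvPolynomial (Fin n) k)).presheaf.stalk p) p.asIdeal :=
        StructureSheaf.IsLocalization.to_stalk (MvPolynomial (Fin n) k) p
      exact IsLocalization.AtPrime.under_maximalIdeal ((Spec.structureSheaf (MvPolynomial (Fin n) k)).presheaf.stalk p) p.asIdeal
    rw [h2, Scheme.Hom.comp_apply, hz0]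
    rfl
  -- (5) hypotheses of the ring-level core
  haveI : Module.Flat (MvPolynomial (Fin n) k) (F₁.presheaf.stalk x) := flat_frameChart n k F₁ ρ x w hw hdim
  have hΛmax : (Ideal.map (algebraMap (MvPolynomial (Fin n) k) (F₁.presheaf.stalk x))
      (Literature.AlgebraicGeometry.Resolution.originIdeal k n)).IsMaximal := by
    rw [RingHom.algebraMap_toAlgebra, (map_originIdeal_frameChart n k F₁ ρ x w hw).1]
    exact IsLocalRing.maximalIdeal.isMaximal _
  haveI : Algebra.FiniteType (MvPolynomial (Fin n) k) Γ(A, U) := hUft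
  haveI : IsNoetherianRing Γ(A, U) := Algebra.FiniteType.isNoetherianRing (MvPolynomial (Fin n) k) Γ(A, U)
  haveI : Algebra.EssFiniteType (MvPolynomial (Fin n) k) Γ(A, U) := inferInstance
  haveI : IsNoetherianRing (Γ(A, U) ⊗[MvPolynomial (Fin n) k] (F₁.presheaf.stalk x)) := by
    haveI : Algebra.FiniteType (F₁.presheaf.stalk x) ((F₁.presheaf.stalk x) ⊗[MvPolynomial (Fin n) k] Γ(A, U)) := inferInstance
    haveI : IsNoetherianRing ((F₁.presheaf.stalk x) ⊗[MvPolynomial (Fin n) k] Γ(A, U)) :=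
      Algebra.FiniteType.isNoetherianRing (F₁.presheaf.stalk x) _
    exact isNoetherianRing_of_ringEquiv ((F₁.presheaf.stalk x) ⊗[MvPolynomial (Fin n) k] Γ(A, U))
      (Algebra.TensorProduct.comm (MvPolynomial (Fin n) k) (F₁.presheaf.stalk x) Γ(A, U)).toRingEquiv
  -- (6) the core: `(Γ(A,U) ⊗ 𝒪ₓ)_𝔔'` is regular since every localization of the regular ring `Γ(A,U)` is
  haveI : IsRegularRing Γ(A, U) := hUreg
  have hreg' : IsRegularLocalRing (Localization.AtPrime ((hV.primeIdealOf ⟨ℓ, hℓV⟩).asIdeal.comap e)) :=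
    (isRegularLocalRing_localization_tensor_iff_of_under_eq_originIdeal k n hΛmax _ hQ').mpr
      (IsRegularRing.isRegularLocalRing_localization _)
  -- (7) transport: `(Γ(A,U) ⊗ 𝒪ₓ)_𝔔' ≅ Γ(L,V)_𝔔 ≅ 𝒪_{L,ℓ}`
  haveI : IsRegularLocalRing (Localization.AtPrime (hV.primeIdealOf ⟨ℓ, hℓV⟩).asIdeal) :=
    IsRegularLocalRing.of_ringEquiv
      (IsLocalization.ringEquivOfRingEquiv (Localization.AtPrime ((hV.primeIdealOf ⟨ℓ, hℓV⟩).asIdeal.comap e))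
        (Localization.AtPrime (hV.primeIdealOf ⟨ℓ, hℓV⟩).asIdeal) e (e.map_primeCompl_comap_eq (hV.primeIdealOf ⟨ℓ, hℓV⟩).asIdeal))
  letI := TopCat.Presheaf.algebra_section_stalk L.presheaf (⟨ℓ, hℓV⟩ : (b ⁻¹ᵁ U ⊓ c ⁻¹ᵁ ⊤ : L.Opens))
  haveI : IsLocalization.AtPrime (L.presheaf.stalk ℓ) (hV.primeIdealOf ⟨ℓ, hℓV⟩).asIdeal := hV.isLocalization_stalk ⟨ℓ, hℓV⟩
  exact IsRegularLocalRing.of_ringEquiv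
    (IsLocalization.algEquiv (hV.primeIdealOf ⟨ℓ, hℓV⟩).asIdeal.primeCompl
      (Localization.AtPrime (hV.primeIdealOf ⟨ℓ, hℓV⟩).asIdeal) (L.presheaf.stalk ℓ)).toRingEquiv

end Summit.ResolutionOfSingularities.ResolutionOfSingularities.Cruxes.EquisingularLiftNat.Sections.ND
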